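import Summits.Ventures.PercRepro.C025ProfilePLDClosureArith

/-!
# PER-LAYER DOMINANCE IS PRESERVED BY ADDING PARALLEL CLASSES — THE CLASS INDUCTION (night-3 g29)

`proofs/NIGHT3-G29-PARALLEL.md` §4.  The finset combinatorics behind `C025ProfilePLDClosureParallel`: a subset `I` of
`B ∪ P` (`P` a class, `B` the rest) is `I' ∪ J` with `I' ⊆ B`, `J ⊆ P` (`sum_powerset_union`); the rank pair of
`I' ∪ J` is that of `I'` plus `(0, 1)`, `(1, 1)` or `(1, 0)` according to `J = ∅`, `J` proper, `J = P`
(`card_image_inter_union`, `card_image_sdiff_union`, `sum_powerset_three`), so the (PLD) sums of the larger family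
are the `coloop` and `shift11` sums of `C025ProfilePLDClosureArith` over the smaller one.  `pld_union_classes`: if
the family `E₁.powerset` with rank functions `ρ`, `ρ'` satisfies (PLD), so does `(E₁ ∪ E₂|_K).powerset` with the
ranks `ρ(I ∩ E₁) + #classes met`, for every finset `K` of classes — by induction on `K`.
No `def`, no `instance`, no notation.  Axioms: standard.
-/

namespace PercRepro

open Finset

namespace PLDClosure

variable {α β : Type} [DecidableEq α] [DecidableEq β]

/-! ### Sums over the powerset of a disjoint union, and over the three states of a class -/

/-- `Σ_{I ⊆ B ∪ P} G I = Σ_{I' ⊆ B} Σ_{J ⊆ P} G (I' ∪ J)` for disjoint `B`, `P`. -/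
theorem sum_powerset_union (B P : Finset α) (hBP : Disjoint B P) (G : Finset α → ℕ) :
    ∑ I ∈ (B ∪ P).powerset, G I = ∑ I' ∈ B.powerset, ∑ J ∈ P.powerset, G (I' ∪ J) := by
  have himg : (B ∪ P).powerset = (B.powerset ×ˢ P.powerset).image (fun p => p.1 ∪ p.2) := by
    ext I
    rw [mem_powerset, mem_image]
    constructor
    · intro hI
      refine ⟨(I ∩ B, I ∩ P), ?_, ?_⟩
      · rw [mem_product, mem_powerset, mem_powerset]
        exact ⟨inter_subset_right, inter_subset_right⟩
      · show I ∩ B ∪ I ∩ P = I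
        rw [← inter_union_distrib_left, inter_eq_left.2 hI]
    · rintro ⟨⟨I', J⟩, hp, rfl⟩
      rw [mem_product, mem_powerset, mem_powerset] at hp
      exact union_subset_union hp.1 hp.2
  have hinj : Set.InjOn (fun p : Finset α × Finset α => p.1 ∪ p.2) ↑(B.powerset ×ˢ P.powerset) := by
    rintro ⟨I₁, J₁⟩ h₁ ⟨I₂, J₂⟩ h₂ h
    rw [Finset.mem_coe, mem_product, mem_powerset, mem_powerset] at h₁ h₂
    simp only at h
    have e1 : ∀ I J, I ⊆ B → J ⊆ P → (I ∪ J) ∩ B = I := by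
      intro I J hI hJ
      have hJB : J ∩ B = ∅ := Finset.disjoint_iff_inter_eq_empty.1 (hBP.mono_right hJ).symm
      rw [union_inter_distrib_right, inter_eq_left.2 hI, hJB, union_empty]
    have e2 : ∀ I J, I ⊆ B → J ⊆ P → (I ∪ J) ∩ P = J := by
      intro I J hI hJ
      have hIP : I ∩ P = ∅ := Finset.disjoint_iff_inter_eq_empty.1 (hBP.mono_left hI)
      rw [union_inter_distrib_right, inter_eq_left.2 hJ, hIP, empty_union]
    have hI : I₁ = I₂ := by rw [← e1 I₁ J₁ h₁.1 h₁.2, ← e1 I₂ J₂ h₂.1 h₂.2, h]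
    have hJ : J₁ = J₂ := by rw [← e2 I₁ J₁ h₁.1 h₁.2, ← e2 I₂ J₂ h₂.1 h₂.2, h]
    rw [hI, hJ]
  rw [himg, Finset.sum_image hinj]
  exact Finset.sum_product B.powerset P.powerset (fun p => G (p.1 ∪ p.2))

/-- The three states of a nonempty class `P`: `J = ∅`, `J` proper, `J = P`. -/
theorem sum_powerset_three (P : Finset α) (hP : P.Nonempty) (Φ : ℕ → ℕ → ℕ) (x f : ℕ) :
    ∑ J ∈ P.powerset, Φ (x + if J = ∅ then 0 else 1) (f + if J = P then 0 else 1) =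
      Φ x (f + 1) + (Φ (x + 1) f + ∑ _J ∈ (P.powerset.erase ∅).erase P, Φ (x + 1) (f + 1)) := by
  have hne : P ≠ ∅ := hP.ne_empty
  rw [← Finset.add_sum_erase P.powerset _ (mem_powerset.2 (empty_subset P)),
    ← Finset.add_sum_erase (P.powerset.erase ∅) _ (mem_erase.2 ⟨hne, mem_powerset.2 le_rfl⟩)]
  rw [if_pos rfl, if_neg hne.symm, if_neg hne, if_pos rfl, add_zero, add_zero, add_left_cancel_iff,
    add_left_cancel_iff]
  refine Finset.sum_congr rfl fun _ hJ => ?_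
  rw [mem_erase, mem_erase] at hJ
  rw [if_neg hJ.2.1, if_neg hJ.1]

/-! ### The class counts of `I' ∪ J` -/

/-- `J ⊆ P = {e ∈ E₂ | c e = j}` meets exactly `[J ≠ ∅]` classes, namely `j`. -/
theorem card_image_subset_class (c : α → β) (E₂ : Finset α) (j : β) (J : Finset α)
    (hJ : J ⊆ E₂.filter (fun e => c e = j)) :
    (J.image c).card = if J = ∅ then 0 else 1 := by
  split_ifs with h
  · rw [h, image_empty, card_empty]
  · have hJne : J.Nonempty := nonempty_iff_ne_empty.2 h
    have : J.image c = {j} := by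
      ext y
      rw [mem_image, mem_singleton]
      constructor
      · rintro ⟨e, he, rfl⟩
        exact (mem_filter.1 (hJ he)).2
      · rintro rfl
        obtain ⟨e, he⟩ := hJne
        exact ⟨e, he, (mem_filter.1 (hJ he)).2⟩
    rw [this, card_singleton]

/-- Classes met by `(I' ∪ J) ∩ (A ∪ P)` for `I' ⊆ B ⊇ A`, `J ⊆ P`, `P` the class `j ∉ K`, `A` the classes in `K`. -/
theorem card_image_inter_union (c : α → β) (E₁ E₂ : Finset α) (hdisj : Disjoint E₁ E₂) (K : Finset β) (j : β)
    (hj : j ∉ K) (I' J : Finset α) (hI' : I' ⊆ E₁ ∪ E₂.filter (fun e => c e ∈ K))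
    (hJ : J ⊆ E₂.filter (fun e => c e = j)) :
    (((I' ∪ J) ∩ (E₂.filter (fun e => c e ∈ K) ∪ E₂.filter (fun e => c e = j))).image c).card =
      ((I' ∩ E₂.filter (fun e => c e ∈ K)).image c).card + (if J = ∅ then 0 else 1) := by
  have hset : (I' ∪ J) ∩ (E₂.filter (fun e => c e ∈ K) ∪ E₂.filter (fun e => c e = j)) =
      I' ∩ E₂.filter (fun e => c e ∈ K) ∪ J := by
    ext e
    simp only [mem_inter, mem_union, mem_filter]
    constructor
    · rintro ⟨hI | hJe, hA | hP⟩
      · exact Or.inl ⟨hI, hA⟩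
      · exact absurd hP.2 (by
          rcases mem_union.1 (hI' hI) with h1 | h1
          · exact fun _ => (disjoint_left.1 hdisj h1) hP.1
          · exact fun h => hj (h ▸ (mem_filter.1 h1).2))
      · exact absurd hA.2 (by
          have := (mem_filter.1 (hJ hJe)).2
          exact fun h => hj (this ▸ h))
      · exact Or.inr hJe
    · rintro (⟨hI, hA⟩ | hJe)
      · exact ⟨Or.inl hI, Or.inl hA⟩
      · exact ⟨Or.inr hJe, Or.inr (mem_filter.1 (hJ hJe))⟩
  have hd : Disjoint ((I' ∩ E₂.filter (fun e => c e ∈ K)).image c) (J.image c) := by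
    rw [disjoint_left]
    intro y hy hyJ
    obtain ⟨e, he, rfl⟩ := mem_image.1 hy
    obtain ⟨e', he', hee'⟩ := mem_image.1 hyJ
    have h1 := (mem_filter.1 (mem_inter.1 he).2).2
    have h2 := (mem_filter.1 (hJ he')).2
    exact hj ((hee'.symm.trans h2) ▸ h1)
  rw [hset, image_union, card_union_of_disjoint hd, card_image_subset_class c E₂ j J hJ]

/-- Classes met by `(A ∪ P) ∖ (I' ∪ J)`: those of `A ∖ I'` plus `[J ≠ P]`. -/
theorem card_image_sdiff_union (c : α → β) (E₁ E₂ : Finset α) (hdisj : Disjoint E₁ E₂) (K : Finset β) (j : β)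
    (hj : j ∉ K) (I' J : Finset α) (hI' : I' ⊆ E₁ ∪ E₂.filter (fun e => c e ∈ K))
    (hJ : J ⊆ E₂.filter (fun e => c e = j)) :
    (((E₂.filter (fun e => c e ∈ K) ∪ E₂.filter (fun e => c e = j)) \ (I' ∪ J)).image c).card =
      ((E₂.filter (fun e => c e ∈ K) \ I').image c).card +
        (if J = E₂.filter (fun e => c e = j) then 0 else 1) := by
  have hset : (E₂.filter (fun e => c e ∈ K) ∪ E₂.filter (fun e => c e = j)) \ (I' ∪ J) =
      (E₂.filter (fun e => c e ∈ K) \ I') ∪ (E₂.filter (fun e => c e = j) \ J) := by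
    ext e
    simp only [mem_sdiff, mem_union, mem_filter, not_or]
    constructor
    · rintro ⟨hA | hP, hI, hJe⟩
      · exact Or.inl ⟨hA, hI⟩
      · exact Or.inr ⟨hP, hJe⟩
    · rintro (⟨hA, hI⟩ | ⟨hP, hJe⟩)
      · refine ⟨Or.inl hA, hI, fun hJe => ?_⟩
        exact hj ((mem_filter.1 (hJ hJe)).2 ▸ hA.2)
      · refine ⟨Or.inr hP, fun hI => ?_, hJe⟩
        rcases mem_union.1 (hI' hI) with h1 | h1
        · exact (disjoint_left.1 hdisj h1) hP.1
        · exact hj (hP.2 ▸ (mem_filter.1 h1).2)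
  have hcard : ((E₂.filter (fun e => c e = j) \ J).image c).card =
      if J = E₂.filter (fun e => c e = j) then 0 else 1 := by
    rw [card_image_subset_class c E₂ j _ sdiff_subset]
    by_cases h : J = E₂.filter (fun e => c e = j)
    · rw [if_pos h, if_pos (by rw [h]; exact sdiff_eq_empty_iff_subset.2 le_rfl)]
    · rw [if_neg h, if_neg]
      intro h'
      exact h (le_antisymm hJ (sdiff_eq_empty_iff_subset.1 h'))
  have hd : Disjoint ((E₂.filter (fun e => c e ∈ K) \ I').image c)
      ((E₂.filter (fun e => c e = j) \ J).image c) := by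
    rw [disjoint_left]
    intro y hy hyJ
    obtain ⟨e, he, rfl⟩ := mem_image.1 hy
    obtain ⟨e', he', hee'⟩ := mem_image.1 hyJ
    have h1 := (mem_filter.1 (mem_sdiff.1 he).1).2
    have h2 := (mem_filter.1 (mem_sdiff.1 he').1).2
    exact hj ((hee'.symm.trans h2) ▸ h1)
  rw [hset, image_union, card_union_of_disjoint hd, hcard]

/-- The `E₁`-parts of `I' ∪ J` and of its complement, for `J ⊆ E₂` disjoint from `E₁`. -/
theorem inter_union_eq_of_subset (E₁ E₂ I' J : Finset α) (hdisj : Disjoint E₁ E₂) (hJ : J ⊆ E₂) :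
    (I' ∪ J) ∩ E₁ = I' ∩ E₁ ∧ E₁ \ (I' ∪ J) = E₁ \ I' := by
  constructor
  · have hJE₁ : J ∩ E₁ = ∅ := Finset.disjoint_iff_inter_eq_empty.1 (hdisj.mono_right hJ).symm
    rw [union_inter_distrib_right, hJE₁, union_empty]
  · ext e
    simp only [mem_sdiff, mem_union, not_or]
    constructor
    · rintro ⟨h1, h2, -⟩; exact ⟨h1, h2⟩
    · rintro ⟨h1, h2⟩
      exact ⟨h1, h2, fun h => (disjoint_left.1 hdisj h1) (hJ h)⟩

/-! ### The induction on the set of classes -/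

/-- (PLD) for the family `(E₁ ∪ E₂|_K).powerset` with ranks `ρ(I ∩ E₁) + #classes`, by induction on the finset `K`
of classes, from (PLD) for `E₁.powerset` with ranks `ρ`, `ρ'`. -/
theorem pld_union_classes (E₁ : Finset α) (ρ ρ' : Finset α → ℕ)
    (hPLD : ∀ lo hi δ Θ : ℕ, Θ ≤ lo + hi + δ → (lo = 0 ∨ lo + hi + δ ≤ Θ) →
      (∑ I ∈ E₁.powerset, (if lo ≤ ρ I ∧ ρ I ≤ hi ∧ Θ ≤ ρ' I + ρ I then (ρ' I).choose δ else 0)) ≤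
        ∑ I ∈ E₁.powerset, (if lo + δ ≤ ρ' I ∧ ρ' I ≤ hi + δ then (ρ' I).choose δ else 0))
    (c : α → β) (E₂ : Finset α) (hdisj : Disjoint E₁ E₂) (K : Finset β) :
    ∀ lo hi δ Θ : ℕ, Θ ≤ lo + hi + δ → (lo = 0 ∨ lo + hi + δ ≤ Θ) →
      (∑ I ∈ (E₁ ∪ E₂.filter (fun e => c e ∈ K)).powerset,
        (if lo ≤ ρ (I ∩ E₁) + ((I ∩ E₂.filter (fun e => c e ∈ K)).image c).card ∧
            ρ (I ∩ E₁) + ((I ∩ E₂.filter (fun e => c e ∈ K)).image c).card ≤ hi ∧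
            Θ ≤ (ρ' (I ∩ E₁) + ((E₂.filter (fun e => c e ∈ K) \ I).image c).card) +
              (ρ (I ∩ E₁) + ((I ∩ E₂.filter (fun e => c e ∈ K)).image c).card) then
          (ρ' (I ∩ E₁) + ((E₂.filter (fun e => c e ∈ K) \ I).image c).card).choose δ else 0)) ≤
      ∑ I ∈ (E₁ ∪ E₂.filter (fun e => c e ∈ K)).powerset,
        (if lo + δ ≤ ρ' (I ∩ E₁) + ((E₂.filter (fun e => c e ∈ K) \ I).image c).card ∧
            ρ' (I ∩ E₁) + ((E₂.filter (fun e => c e ∈ K) \ I).image c).card ≤ hi + δ then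
          (ρ' (I ∩ E₁) + ((E₂.filter (fun e => c e ∈ K) \ I).image c).card).choose δ else 0) := by
  induction K using Finset.induction_on with
  | empty =>
    intro lo hi δ Θ hΘ hlo
    have hA : E₂.filter (fun e => c e ∈ (∅ : Finset β)) = ∅ := by
      rw [Finset.filter_eq_empty_iff]
      intro e _ h
      exact Finset.notMem_empty _ h
    rw [hA, union_empty]
    refine (Finset.sum_congr rfl fun I hI => ?_).trans_le
      ((hPLD lo hi δ Θ hΘ hlo).trans_eq (Finset.sum_congr rfl fun I hI => ?_))
    · rw [mem_powerset] at hI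
      simp only [inter_eq_left.2 hI, inter_empty, image_empty, card_empty, empty_sdiff, add_zero]
    · rw [mem_powerset] at hI
      simp only [inter_eq_left.2 hI, empty_sdiff, image_empty, card_empty, add_zero]
  | insert j K hj ih =>
    intro lo hi δ Θ hΘ hlo
    -- the new block `P` and the split of the filter
    have hsplit : E₂.filter (fun e => c e ∈ insert j K) =
        E₂.filter (fun e => c e ∈ K) ∪ E₂.filter (fun e => c e = j) := by
      rw [← Finset.filter_or]
      refine Finset.filter_congr fun e _ => ?_
      rw [mem_insert, or_comm]
    rw [hsplit]
    by_cases hP : E₂.filter (fun e => c e = j) = ∅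
    · rw [hP, union_empty]
      exact ih lo hi δ Θ hΘ hlo
    have hPne : (E₂.filter (fun e => c e = j)).Nonempty := nonempty_iff_ne_empty.2 hP
    have hBP : Disjoint (E₁ ∪ E₂.filter (fun e => c e ∈ K)) (E₂.filter (fun e => c e = j)) := by
      rw [disjoint_left]
      intro e he hP'
      rcases mem_union.1 he with h1 | h1
      · exact (disjoint_left.1 hdisj h1) (mem_filter.1 hP').1
      · exact hj ((mem_filter.1 hP').2 ▸ (mem_filter.1 h1).2)
    rw [← union_assoc, sum_powerset_union _ _ hBP, sum_powerset_union _ _ hBP]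
    -- the summands of `I' ∪ J` in terms of those of `I'`
    have hL : ∀ I' ∈ (E₁ ∪ E₂.filter (fun e => c e ∈ K)).powerset,
        ∑ J ∈ (E₂.filter (fun e => c e = j)).powerset,
          (if lo ≤ ρ ((I' ∪ J) ∩ E₁) + (((I' ∪ J) ∩ (E₂.filter (fun e => c e ∈ K) ∪
                E₂.filter (fun e => c e = j))).image c).card ∧
              ρ ((I' ∪ J) ∩ E₁) + (((I' ∪ J) ∩ (E₂.filter (fun e => c e ∈ K) ∪
                E₂.filter (fun e => c e = j))).image c).card ≤ hi ∧
              Θ ≤ (ρ' ((I' ∪ J) ∩ E₁) + (((E₂.filter (fun e => c e ∈ K) ∪ E₂.filter (fun e => c e = j)) \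
                (I' ∪ J)).image c).card) + (ρ ((I' ∪ J) ∩ E₁) + (((I' ∪ J) ∩ (E₂.filter (fun e => c e ∈ K) ∪
                E₂.filter (fun e => c e = j))).image c).card) then
            (ρ' ((I' ∪ J) ∩ E₁) + (((E₂.filter (fun e => c e ∈ K) ∪ E₂.filter (fun e => c e = j)) \
              (I' ∪ J)).image c).card).choose δ else 0) =
        (fun x f => if lo ≤ x ∧ x ≤ hi ∧ Θ ≤ f + x then f.choose δ else 0)
            (ρ (I' ∩ E₁) + ((I' ∩ E₂.filter (fun e => c e ∈ K)).image c).card)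
            (ρ' (I' ∩ E₁) + ((E₂.filter (fun e => c e ∈ K) \ I').image c).card + 1) +
          ((fun x f => if lo ≤ x ∧ x ≤ hi ∧ Θ ≤ f + x then f.choose δ else 0)
            (ρ (I' ∩ E₁) + ((I' ∩ E₂.filter (fun e => c e ∈ K)).image c).card + 1)
            (ρ' (I' ∩ E₁) + ((E₂.filter (fun e => c e ∈ K) \ I').image c).card) +
          ∑ J ∈ ((E₂.filter (fun e => c e = j)).powerset.erase ∅).erase (E₂.filter (fun e => c e = j)),
            (fun x f => if lo ≤ x ∧ x ≤ hi ∧ Θ ≤ f + x then f.choose δ else 0)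
              (ρ (I' ∩ E₁) + ((I' ∩ E₂.filter (fun e => c e ∈ K)).image c).card + 1)
              (ρ' (I' ∩ E₁) + ((E₂.filter (fun e => c e ∈ K) \ I').image c).card + 1)) := by
      intro I' hI'
      rw [mem_powerset] at hI'
      refine (Finset.sum_congr rfl fun J hJ => ?_).trans (sum_powerset_three _ hPne
        (fun x f => if lo ≤ x ∧ x ≤ hi ∧ Θ ≤ f + x then f.choose δ else 0)
        (ρ (I' ∩ E₁) + ((I' ∩ E₂.filter (fun e => c e ∈ K)).image c).card)
        (ρ' (I' ∩ E₁) + ((E₂.filter (fun e => c e ∈ K) \ I').image c).card))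
      rw [mem_powerset] at hJ
      have hJE : J ⊆ E₂ := hJ.trans (filter_subset _ _)
      obtain ⟨e1, -⟩ := inter_union_eq_of_subset E₁ E₂ I' J hdisj hJE
      rw [e1, card_image_inter_union c E₁ E₂ hdisj K j hj I' J hI' hJ,
        card_image_sdiff_union c E₁ E₂ hdisj K j hj I' J hI' hJ]
      simp only [add_assoc]
    have hR : ∀ I' ∈ (E₁ ∪ E₂.filter (fun e => c e ∈ K)).powerset,
        ∑ J ∈ (E₂.filter (fun e => c e = j)).powerset,
          (if lo + δ ≤ ρ' ((I' ∪ J) ∩ E₁) + (((E₂.filter (fun e => c e ∈ K) ∪ E₂.filter (fun e => c e = j)) \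
                (I' ∪ J)).image c).card ∧
              ρ' ((I' ∪ J) ∩ E₁) + (((E₂.filter (fun e => c e ∈ K) ∪ E₂.filter (fun e => c e = j)) \
                (I' ∪ J)).image c).card ≤ hi + δ then
            (ρ' ((I' ∪ J) ∩ E₁) + (((E₂.filter (fun e => c e ∈ K) ∪ E₂.filter (fun e => c e = j)) \
              (I' ∪ J)).image c).card).choose δ else 0) =
        (fun _ f => if lo + δ ≤ f ∧ f ≤ hi + δ then f.choose δ else 0)
            (ρ (I' ∩ E₁) + ((I' ∩ E₂.filter (fun e => c e ∈ K)).image c).card)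
            (ρ' (I' ∩ E₁) + ((E₂.filter (fun e => c e ∈ K) \ I').image c).card + 1) +
          ((fun _ f => if lo + δ ≤ f ∧ f ≤ hi + δ then f.choose δ else 0)
            (ρ (I' ∩ E₁) + ((I' ∩ E₂.filter (fun e => c e ∈ K)).image c).card + 1)
            (ρ' (I' ∩ E₁) + ((E₂.filter (fun e => c e ∈ K) \ I').image c).card) +
          ∑ J ∈ ((E₂.filter (fun e => c e = j)).powerset.erase ∅).erase (E₂.filter (fun e => c e = j)),
            (fun _ f => if lo + δ ≤ f ∧ f ≤ hi + δ then f.choose δ else 0)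
              (ρ (I' ∩ E₁) + ((I' ∩ E₂.filter (fun e => c e ∈ K)).image c).card + 1)
              (ρ' (I' ∩ E₁) + ((E₂.filter (fun e => c e ∈ K) \ I').image c).card + 1)) := by
      intro I' hI'
      rw [mem_powerset] at hI'
      refine (Finset.sum_congr rfl fun J hJ => ?_).trans (sum_powerset_three _ hPne
        (fun _ f => if lo + δ ≤ f ∧ f ≤ hi + δ then f.choose δ else 0)
        (ρ (I' ∩ E₁) + ((I' ∩ E₂.filter (fun e => c e ∈ K)).image c).card)
        (ρ' (I' ∩ E₁) + ((E₂.filter (fun e => c e ∈ K) \ I').image c).card))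
      rw [mem_powerset] at hJ
      have hJE : J ⊆ E₂ := hJ.trans (filter_subset _ _)
      obtain ⟨e1, -⟩ := inter_union_eq_of_subset E₁ E₂ I' J hdisj hJE
      rw [e1, card_image_sdiff_union c E₁ E₂ hdisj K j hj I' J hI' hJ]
      simp only [add_assoc]
    rw [Finset.sum_congr rfl hL, Finset.sum_congr rfl hR]
    simp only [Finset.sum_add_distrib]
    rw [Finset.sum_comm (s := (E₁ ∪ E₂.filter (fun e => c e ∈ K)).powerset),
      Finset.sum_comm (s := (E₁ ∪ E₂.filter (fun e => c e ∈ K)).powerset)]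
    -- the coloop part and the proper parts
    have hcol := coloop (E₁ ∪ E₂.filter (fun e => c e ∈ K)).powerset
      (fun I' => ρ (I' ∩ E₁) + ((I' ∩ E₂.filter (fun e => c e ∈ K)).image c).card)
      (fun I' => ρ' (I' ∩ E₁) + ((E₂.filter (fun e => c e ∈ K) \ I').image c).card) ih lo hi δ Θ hΘ hlo
    have hsh : ∀ J ∈ ((E₂.filter (fun e => c e = j)).powerset.erase ∅).erase (E₂.filter (fun e => c e = j)),
        ∑ I' ∈ (E₁ ∪ E₂.filter (fun e => c e ∈ K)).powerset,
          (fun x f => if lo ≤ x ∧ x ≤ hi ∧ Θ ≤ f + x then f.choose δ else 0)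
            (ρ (I' ∩ E₁) + ((I' ∩ E₂.filter (fun e => c e ∈ K)).image c).card + 1)
            (ρ' (I' ∩ E₁) + ((E₂.filter (fun e => c e ∈ K) \ I').image c).card + 1) ≤
        ∑ I' ∈ (E₁ ∪ E₂.filter (fun e => c e ∈ K)).powerset,
          (fun _ f => if lo + δ ≤ f ∧ f ≤ hi + δ then f.choose δ else 0)
            (ρ (I' ∩ E₁) + ((I' ∩ E₂.filter (fun e => c e ∈ K)).image c).card + 1)
            (ρ' (I' ∩ E₁) + ((E₂.filter (fun e => c e ∈ K) \ I').image c).card + 1) := by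
      intro J _
      exact shift11 (E₁ ∪ E₂.filter (fun e => c e ∈ K)).powerset
        (fun I' => ρ (I' ∩ E₁) + ((I' ∩ E₂.filter (fun e => c e ∈ K)).image c).card)
        (fun I' => ρ' (I' ∩ E₁) + ((E₂.filter (fun e => c e ∈ K) \ I').image c).card) ih lo hi δ Θ hΘ hlo
    have hsum := Finset.sum_le_sum hsh
    rw [Finset.sum_add_distrib, Finset.sum_add_distrib] at hcol
    beta_reduce at hcol hsum ⊢
    omega

end PLDClosure

end PercRepro
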